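/-
Copyright: public-domain mathematics; typed transcription for the H21 Literature library (cell lit-balaban,
writer seat p40 gen 12 = literature-prover-lit-balaban-p40-g12-0).

statement-level skeleton of published theorems with citation tags; proofs where landed; nothing here is a claim
about the Yang–Mills mass gap

# Bałaban, *Propagators for lattice gauge theories in a background field*, Commun. Math. Phys. **99** (1985)
# 389–434 — (3.18) p. 393 and p. 394: the block system of Q′ (the blocks of Ω₁ together with the 0-blocks = single
# sites off Ω₁) CONSTRUCTED on the lattice T_η and on every domain Ω₀ ⊇ Ω₁, and «R in terms of operators with some
# boundary conditions outside Ω₁» with the modelling hypotheses of `B9Eq321DirichletIndependence` DISCHARGED.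

THE PRINTED SENTENCES ([B9] pp. 393–394, verbatim, as verified for `B9Eq321DirichletIndependence`, whose header
quotes the whole paragraph): «we define Λ_j = Ω_j^{(j)} ∖ Ω_{j+1}^{(j)}, j = 0, 1, …, k, Ω_{k+1} = ∅, or
Ω_j ∖ Ω_{j+1} = B^j(Λ_j)»; «where Q′λ is defined on 𝔅 = ⋃_{j=0}^{k} Λ_j by the formulas (Q′λ)(y) = (Q′_j(U)λ)(y) for
y ∈ Λ_j, (3.18)»; «(Q′_j(U)λ)(y) = … = Σ_{x∈B^j(y)} L^{−jd} R(U(Γ^{(j)}_{y,x}))λ(x), y ∈ T^{(j)}_{L^jη}. (3.19)»;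
p. 394: «By the definition of space N(Q′) the functions λ in (3.22) vanish on Ω₁^c. This permits us to express R in
terms of operators with some boundary conditions outside Ω₁. We will use only Dirichlet boundary conditions. Let us
introduce a domain Ω₀ such that Ω₁ ⊂ Ω₀ and Ω₀ is a union of big blocks of the lattice T₁, e.g. … or we may add to
Ω₁ a thinner layer of the big blocks surrounding Ω₁. For such Ω₀ we consider the operator Δ′_a with Dirichlet
boundary conditions on ∂Ω₀, i.e. the operator Δ′_a↾Ω₀ = Ω₀Δ′_aΩ₀»; «Usually we will not mention it, and we do not
indicate this fact in our notations.»

WHAT THIS FILE DOES.  `B9Eq321DirichletIndependence.R325_dirichlet_indep_blocks` (p40 gen 11) proves Ω₀R↾Ω₀ =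
Ω₀′R′↾Ω₀′ for two admissible domains from MODELLING hypotheses on three abstract block systems (one on T_η, one on
each domain): `hsing` (every site off Ω₁ is a 0-block of the T_η-system), `hoff` (the T_η-blocks not coming from the
domain are single sites off it) and the compatibility family `hB`/`hw`/`hΓ`/`hy` (the domain's blocks are the
T_η-blocks inside it).  Here these systems are CONSTRUCTED from the printed data — a block system on Ω₁ (the blocks
of order j ≥ 1, abstractly: `B9Thm311Lattice.IsBlockSystem` for the bonds inside Ω₁) — exactly as (3.18) prescribes:
on Λ₀ = Ω₀ ∖ Ω₁ the blocks are the 0-blocks B⁰(y) = {y} with weight L⁰ = 1 and trivial contour, so (Q′λ)(y) = λ(y)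
there; and all the modelling hypotheses are PROVED for the construction.
* §1 `extB`/`extW`/`extΓ`/`extY`: a block system on Ω₁ pushed forward along a copy X′ ⊇ Ω₁ of part of the lattice
  (X′ = T_η itself, or X′ = a domain Ω₀ ⊇ Ω₁) and completed by the 0-blocks at the sites of X′ off Ω₁;
  **`isBlockSystem_ext`**: the result is an `IsBlockSystem` (for any bond set containing the images of the Ω₁-bonds).
* §2 the two instances: the T_η-system (X′ = T_η; `isBlockSystem_T`, `singleton_T` = `hsing`) and, for Ω₀ ⊇ Ω₁, the
  Ω₀-system (X′ = Ω₀, `inclS`; `isBlockSystem_S`), with the compatibility family `extB_compat`/`extW_compat`/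
  `extΓ_compat`/`extY_compat` and `offRange_compat` (= `hoff`) PROVED; the operators **`qT`** (the T_η-constraints
  Q_T on L²(T_η, 𝔤)) and **`qS`** (the constructed Q′ on L²(Ω₀, 𝔤)), hence **`qS_ker_iff`**: Q′λ = 0 ⟺ Q_T(Ω₀λ) = 0,
  and **`apply_eq_zero_of_qS`**: «the functions λ in (3.22) vanish on Ω₁^c».
* §3 the printed statements with only printed hypotheses left: **`exists_data_qS`** (Thm 3.11 «obvious»: the
  (3.25)-data of the Dirichlet operator Ω₀Δ_TΩ₀ with the constructed Q′ exist — positive bond weights, injective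
  transports isometric on the bonds entering Ω₀, a_c > 0), **`R325_dirichlet_indep`** (Ω₀R↾Ω₀ = Ω₀′R′↾Ω₀′ for ANY two
  domains containing Ω₁ together with every site bonded to Ω₁ and ANY (3.25)-data on them — bond weights ≥ 0, nothing
  else), **`norm_R325_resS_indep`** (the exponent ‖R(D\*A↾Ω₀)‖ of (3.20) likewise).
* §4 (v1.1, append-only) «They depend on the configuration U restricted to Ω₀» (p. 394) for the constructed
  system: **`qS_congr`** (Q′ reads the transports only between sites of Ω₀), **`R325_qS_congr`** (hence so does the
  (3.25) expression R), **`data_qS_local`** (a (3.25)-datum for U is one for every U′ agreeing with U on Ω₀ —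
  `B9Eq323DirichletSplit.data_dirichlet_local` for the constructed Q′).

VERSIONS.  v1.0 = p319457 (§§1–3).  v1.1 (p40 gen 12, append-only): §4; §§1–3 byte-identical.

HONEST SCOPE.  (i) The multi-level structure of the Ω₁-blocks (orders j = 1, …, k, Λ_j ⊂ T^{(j)}) is abstracted into
one `IsBlockSystem` on Ω₁, as everywhere in this lineage (`B9Thm311Lattice`; the cube/level instances are
`B9BlockSystemCubes`/`B9BlockSystemSigma`); weights unnormalised (DIVERGENCE D-b09.24).  (ii) «Ω₀ is a union of big
blocks of the lattice T₁» serves the later M-cube random-walk expansions; for R only «Ω₁ plus a layer» (no bond from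
Ω₁ to T_η ∖ Ω₀, hypothesis `hlayer`) matters, and with the 0-blocks every Ω₀ ⊇ Ω₁ is a union of blocks.  (iii) No
bound, no measure; finite-dimensional linear algebra; value = the modelling hypotheses of the gen-11 theorem turned
into a construction + theorems, NOT summit progress.
-/
import Mathlib
import Literature.MathematicalPhysics.QuantumFieldTheory.Balaban1983to89.B9Eq321DirichletIndependence

namespace Literature.MathematicalPhysics.QuantumFieldTheory.Balaban1983to89.B9Eq318DirichletBlocks

open Finset
open Literature.MathematicalPhysics.QuantumFieldTheory.Balaban1983to89.B9Eq323Ker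
  Literature.MathematicalPhysics.QuantumFieldTheory.Balaban1983to89.B9Thm311Lattice
  Literature.MathematicalPhysics.QuantumFieldTheory.Balaban1983to89.B9Eq325Proj
  Literature.MathematicalPhysics.QuantumFieldTheory.Balaban1983to89.B9Eq323DirichletSplit
  Literature.MathematicalPhysics.QuantumFieldTheory.Balaban1983to89.B9Eq321DirichletIndependence
open scoped InnerProductSpace

variable {Xt : Type*} [DecidableEq Xt] (Ω₁ : Finset Xt) {Y : Type*}

/-! ## §1  Ω₁-blocks pushed forward to X′ ⊇ Ω₁ and completed by 0-blocks -/

section Extend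

variable {X' : Type*} [DecidableEq X'] (π : X' → Xt) (e : ↥Ω₁ → X')

/-- **The blocks of (3.18) on X′**: the Ω₁-blocks B^j(y), j ≥ 1 (pushed forward along e : Ω₁ → X′), and for every
site x′ of X′ off Ω₁ the 0-block B⁰(x′) = {x′}.  Index type: the Ω₁-centres ⊕ the sites off Ω₁ (= Λ₀ when X′ = Ω₀).
[cite: Balaban1985BackgroundPropagators, (3.18) p. 393] -/
def extB (B : Y → Finset ↥Ω₁) : Y ⊕ {x' : X' // π x' ∉ Ω₁} → Finset X'
  | Sum.inl c => (B c).image e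
  | Sum.inr x => {x.1}

/-- **The weights of (3.18)–(3.19) on X′**: L^{−jd}-type weights of the Ω₁-blocks read through π : X′ → T_η (zero off
Ω₁), and L⁰ = 1 on the 0-blocks. [cite: Balaban1985BackgroundPropagators, (3.18)-(3.19) p. 393] -/
def extW (w : Y → ↥Ω₁ → ℝ) : Y ⊕ {x' : X' // π x' ∉ Ω₁} → X' → ℝ
  | Sum.inl c => fun x' => if h : π x' ∈ Ω₁ then w c ⟨π x', h⟩ else 0
  | Sum.inr _ => fun _ => 1

/-- **The contours of (3.19) on X′**: the contours Γ^{(j)}_{y,x} of the Ω₁-blocks pushed forward along e, and the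
trivial contour on the 0-blocks. [cite: Balaban1985BackgroundPropagators, (3.19) p. 393] -/
def extΓ (Γ : Y → ↥Ω₁ → List ↥Ω₁) : Y ⊕ {x' : X' // π x' ∉ Ω₁} → X' → List X'
  | Sum.inl c => fun x' => if h : π x' ∈ Ω₁ then (Γ c ⟨π x', h⟩).map e else []
  | Sum.inr _ => fun _ => []

/-- **The centres**: y for the Ω₁-block B^j(y), the site itself for a 0-block.
[cite: Balaban1985BackgroundPropagators, (3.18) p. 393] -/
def extY (y : Y → ↥Ω₁) : Y ⊕ {x' : X' // π x' ∉ Ω₁} → X'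
  | Sum.inl c => e (y c)
  | Sum.inr x => x.1

variable {π e} (hπe : ∀ z : ↥Ω₁, π (e z) = z) (hπ : Function.Injective π)
include hπe

omit [DecidableEq Xt] [DecidableEq X'] in
/-- e is injective (π ∘ e is the inclusion Ω₁ ⊂ T_η). [folklore] -/
private theorem e_injective : Function.Injective e := fun z z' h =>
  Subtype.ext (by rw [← hπe z, ← hπe z', h])

omit [DecidableEq X'] in
/-- The weight of an Ω₁-block at a site of Ω₁ is the given one.
[cite: Balaban1985BackgroundPropagators, (3.19) p. 393] -/
theorem extW_inl_e (w : Y → ↥Ω₁ → ℝ) (c : Y) (z : ↥Ω₁) : extW Ω₁ π w (Sum.inl c) (e z) = w c z := by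
  have h : π (e z) ∈ Ω₁ := by rw [hπe]; exact z.2
  show (if h : π (e z) ∈ Ω₁ then w c ⟨π (e z), h⟩ else 0) = w c z
  rw [dif_pos h]
  congr 1
  exact Subtype.ext (hπe z)

omit [DecidableEq X'] in
/-- The contour of an Ω₁-block to a site of Ω₁ is the given one, pushed forward.
[cite: Balaban1985BackgroundPropagators, (3.19) p. 393] -/
theorem extΓ_inl_e (Γ : Y → ↥Ω₁ → List ↥Ω₁) (c : Y) (z : ↥Ω₁) :
    extΓ Ω₁ π e Γ (Sum.inl c) (e z) = (Γ c z).map e := by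
  have h : π (e z) ∈ Ω₁ := by rw [hπe]; exact z.2
  show (if h : π (e z) ∈ Ω₁ then (Γ c ⟨π (e z), h⟩).map e else []) = (Γ c z).map e
  rw [dif_pos h]
  congr 2
  exact Subtype.ext (hπe z)

include hπ

/-- **The (3.18) system on X′ is a block system** (`B9Thm311Lattice.IsBlockSystem`) for every bond set of X′
containing the images of the bonds of Ω₁ along which the given contours run: contours are bond chains from the
centre to the site, block weight sums ≠ 0, the blocks cover X′ (a site off Ω₁ is its own 0-block), centres with
trivial contour and weight ≠ 0, distinct centres not in each other's blocks.
[cite: Balaban1985BackgroundPropagators, (3.18)-(3.19) p. 393] -/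
theorem isBlockSystem_ext {bonds₁ : Finset (↥Ω₁ × ↥Ω₁)} {bonds' : Finset (X' × X')}
    (hb : ∀ a b : ↥Ω₁, (a, b) ∈ bonds₁ → (e a, e b) ∈ bonds') {w : Y → ↥Ω₁ → ℝ} {B : Y → Finset ↥Ω₁}
    {Γ : Y → ↥Ω₁ → List ↥Ω₁} {y : Y → ↥Ω₁} (hS : IsBlockSystem bonds₁ w B Γ y) :
    IsBlockSystem bonds' (extW Ω₁ π w) (extB Ω₁ π e B) (extΓ Ω₁ π e Γ) (extY Ω₁ π e y) where
  chain c x' hx' := by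
    rcases c with c | x
    · obtain ⟨z, hz, rfl⟩ := Finset.mem_image.mp hx'
      have eq : extY Ω₁ π e y (Sum.inl c) :: extΓ Ω₁ π e Γ (Sum.inl c) (e z) = (y c :: Γ c z).map e := by
        rw [extΓ_inl_e Ω₁ hπe, List.map_cons]
        rfl
      rw [eq]
      exact List.isChain_map_of_isChain e (fun a b h => hb a b h) (hS.chain c z hz)
    · exact List.isChain_singleton _
  last c x' hx' := by
    rcases c with c | x
    · obtain ⟨z, hz, rfl⟩ := Finset.mem_image.mp hx'
      have eq : extY Ω₁ π e y (Sum.inl c) :: extΓ Ω₁ π e Γ (Sum.inl c) (e z) = (y c :: Γ c z).map e := by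
        rw [extΓ_inl_e Ω₁ hπe, List.map_cons]
        rfl
      simp only [eq, List.getLast_map, hS.last c z hz]
    · have hx : x' = x.1 := Finset.mem_singleton.mp hx'
      subst hx
      rfl
  sum_ne c := by
    rcases c with c | x
    · show ∑ x' ∈ (B c).image e, extW Ω₁ π w (Sum.inl c) x' ≠ 0
      rw [Finset.sum_image fun a _ b _ h => e_injective Ω₁ hπe h,
        Finset.sum_congr rfl fun z _ => extW_inl_e Ω₁ hπe w c z]
      exact hS.sum_ne c
    · show ∑ x' ∈ ({x.1} : Finset X'), (1 : ℝ) ≠ 0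
      rw [Finset.sum_singleton]
      exact one_ne_zero
  cover x' := by
    by_cases h : π x' ∈ Ω₁
    · obtain ⟨c, hc⟩ := hS.cover ⟨π x', h⟩
      exact ⟨Sum.inl c, Finset.mem_image.mpr ⟨_, hc, hπ (hπe _)⟩⟩
    · exact ⟨Sum.inr ⟨x', h⟩, Finset.mem_singleton_self _⟩
  centre_mem c := by
    rcases c with c | x
    · exact Finset.mem_image_of_mem e (hS.centre_mem c)
    · exact Finset.mem_singleton_self _
  centre_path c := by
    rcases c with c | x
    · show extΓ Ω₁ π e Γ (Sum.inl c) (e (y c)) = []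
      rw [extΓ_inl_e Ω₁ hπe, hS.centre_path c, List.map_nil]
    · rfl
  centre_wt c := by
    rcases c with c | x
    · show extW Ω₁ π w (Sum.inl c) (e (y c)) ≠ 0
      rw [extW_inl_e Ω₁ hπe]
      exact hS.centre_wt c
    · exact one_ne_zero
  disj c c' hne hmem := by
    rcases c with c | x <;> rcases c' with c' | x'
    · obtain ⟨z, hz, hze⟩ := Finset.mem_image.mp hmem
      have hzy : z = y c' := e_injective Ω₁ hπe hze
      subst hzy
      exact hS.disj c c' (fun h => hne (by rw [h])) hz
    · obtain ⟨z, _, hze⟩ := Finset.mem_image.mp hmem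
      exact x'.2 (by rw [← show e z = x'.1 from hze, hπe]; exact z.2)
    · have hze : e (y c') = x.1 := Finset.mem_singleton.mp hmem
      exact x.2 (by rw [← hze, hπe]; exact (y c').2)
    · have h : x'.1 = x.1 := Finset.mem_singleton.mp hmem
      exact hne (by rw [Subtype.ext h])

end Extend

/-! ## §2  The T_η-system and, for Ω₀ ⊇ Ω₁, the Ω₀-system; the compatibility family of
`B9Eq321DirichletIndependence` §5 proved -/

section Instances

variable (S : Finset Xt) (hΩ : Ω₁ ⊆ S)

/-- The inclusion Ω₁ ⊂ Ω₀ of site carriers. [cite: Balaban1985BackgroundPropagators, p. 394] -/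
def inclS : ↥Ω₁ → ↥S := fun z => ⟨z, hΩ z.2⟩

/-- **The T_η-system** (X′ = T_η: Ω₁-blocks and a 0-block at every site of T_η off Ω₁) **is a block system** for the
bonds of T_η, whenever the Ω₁-system is one for the bonds inside Ω₁.
[cite: Balaban1985BackgroundPropagators, (3.18)-(3.19) p. 393] -/
theorem isBlockSystem_T {bonds : Finset (Xt × Xt)} {w : Y → ↥Ω₁ → ℝ} {B : Y → Finset ↥Ω₁}
    {Γ : Y → ↥Ω₁ → List ↥Ω₁} {y : Y → ↥Ω₁} (hS : IsBlockSystem (intBonds Ω₁ bonds) w B Γ y) :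
    IsBlockSystem bonds (extW Ω₁ id w) (extB Ω₁ id Subtype.val B) (extΓ Ω₁ id Subtype.val Γ)
      (extY Ω₁ id Subtype.val y) :=
  isBlockSystem_ext Ω₁ (π := id) (e := Subtype.val) (fun _ => rfl) (fun _ _ h => h)
    (fun a b h => (mem_intBonds Ω₁ bonds (a, b)).1 h) hS

/-- **The Ω₀-system** (X′ = Ω₀ ⊇ Ω₁: Ω₁-blocks and the 0-blocks of Λ₀ = Ω₀ ∖ Ω₁) **is a block system** for the bonds
inside Ω₀. [cite: Balaban1985BackgroundPropagators, (3.18)-(3.19) p. 393, p. 394] -/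
theorem isBlockSystem_S {bonds : Finset (Xt × Xt)} {w : Y → ↥Ω₁ → ℝ} {B : Y → Finset ↥Ω₁}
    {Γ : Y → ↥Ω₁ → List ↥Ω₁} {y : Y → ↥Ω₁} (hS : IsBlockSystem (intBonds Ω₁ bonds) w B Γ y) :
    IsBlockSystem (intBonds S bonds) (extW Ω₁ (Subtype.val : ↥S → Xt) w)
      (extB Ω₁ Subtype.val (inclS Ω₁ S hΩ) B) (extΓ Ω₁ Subtype.val (inclS Ω₁ S hΩ) Γ)
      (extY Ω₁ Subtype.val (inclS Ω₁ S hΩ) y) :=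
  isBlockSystem_ext Ω₁ (π := (Subtype.val : ↥S → Xt)) (e := inclS Ω₁ S hΩ) (fun _ => rfl) Subtype.val_injective
    (fun a b h => (mem_intBonds S bonds _).2 ((mem_intBonds Ω₁ bonds (a, b)).1 h)) hS

/-- **Every site of T_η off Ω₁ is a 0-block of the T_η-system** (hypothesis `hsing` of
`B9Eq321DirichletIndependence` §5, by construction). [cite: Balaban1985BackgroundPropagators, (3.18) p. 393] -/
theorem singleton_T (w : Y → ↥Ω₁ → ℝ) (B : Y → Finset ↥Ω₁) (Γ : Y → ↥Ω₁ → List ↥Ω₁) (y : Y → ↥Ω₁)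
    (x : Xt) (hx : x ∉ Ω₁) :
    ∃ cT : Y ⊕ {x' : Xt // id x' ∉ Ω₁}, extB Ω₁ id Subtype.val B cT = {x} ∧ extY Ω₁ id Subtype.val y cT = x ∧
      extΓ Ω₁ id Subtype.val Γ cT x = [] ∧ extW Ω₁ id w cT x ≠ 0 :=
  ⟨Sum.inr ⟨x, hx⟩, rfl, rfl, rfl, one_ne_zero⟩

/-- The Ω₀-blocks as T_η-blocks: ι of `B9Eq321DirichletIndependence` §5.
[cite: Balaban1985BackgroundPropagators, (3.18) p. 393, p. 394] -/
def ιS : Y ⊕ {x : ↥S // (x : Xt) ∉ Ω₁} → Y ⊕ {x' : Xt // id x' ∉ Ω₁} :=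
  Sum.map id fun x => ⟨(x.1 : Xt), x.2⟩

/-- `hB`: the T_η-block of ι(c) is the Ω₀-block of c read in T_η.
[cite: Balaban1985BackgroundPropagators, (3.18) p. 393, p. 394] -/
theorem extB_compat (B : Y → Finset ↥Ω₁) (c : Y ⊕ {x : ↥S // (x : Xt) ∉ Ω₁}) :
    extB Ω₁ id Subtype.val B (ιS Ω₁ S c)
      = (extB Ω₁ Subtype.val (inclS Ω₁ S hΩ) B c).map (Function.Embedding.subtype (· ∈ S)) := by
  rcases c with c | x
  · show (B c).image Subtype.val = ((B c).image (inclS Ω₁ S hΩ)).map (Function.Embedding.subtype (· ∈ S))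
    rw [Finset.map_eq_image, Finset.image_image]
    rfl
  · show ({(x.1 : Xt)} : Finset Xt) = ({x.1} : Finset ↥S).map (Function.Embedding.subtype (· ∈ S))
    rw [Finset.map_singleton]
    rfl

/-- `hw`: the weights agree. [cite: Balaban1985BackgroundPropagators, (3.19) p. 393] -/
theorem extW_compat (w : Y → ↥Ω₁ → ℝ) (c : Y ⊕ {x : ↥S // (x : Xt) ∉ Ω₁}) (x : ↥S) :
    extW Ω₁ id w (ιS Ω₁ S c) x = extW Ω₁ (Subtype.val : ↥S → Xt) w c x := by
  rcases c with c | x'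
  · rfl
  · rfl

/-- `hΓ`: the contours agree. [cite: Balaban1985BackgroundPropagators, (3.19) p. 393] -/
theorem extΓ_compat (Γ : Y → ↥Ω₁ → List ↥Ω₁) (c : Y ⊕ {x : ↥S // (x : Xt) ∉ Ω₁}) (x : ↥S) :
    extΓ Ω₁ id Subtype.val Γ (ιS Ω₁ S c) x
      = (extΓ Ω₁ Subtype.val (inclS Ω₁ S hΩ) Γ c x).map Subtype.val := by
  rcases c with c | x'
  · show (if h : (x : Xt) ∈ Ω₁ then (Γ c ⟨x, h⟩).map Subtype.val else [])
        = (if h : (x : Xt) ∈ Ω₁ then (Γ c ⟨x, h⟩).map (inclS Ω₁ S hΩ) else []).map Subtype.val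
    by_cases h : (x : Xt) ∈ Ω₁
    · rw [dif_pos h, dif_pos h, List.map_map]
      rfl
    · rw [dif_neg h, dif_neg h, List.map_nil]
  · rfl

omit [DecidableEq Xt] in
/-- `hy`: the centres agree. [cite: Balaban1985BackgroundPropagators, (3.18) p. 393] -/
theorem extY_compat (y : Y → ↥Ω₁) (c : Y ⊕ {x : ↥S // (x : Xt) ∉ Ω₁}) :
    extY Ω₁ id Subtype.val y (ιS Ω₁ S c) = ((extY Ω₁ Subtype.val (inclS Ω₁ S hΩ) y c : ↥S) : Xt) := by
  rcases c with c | x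
  · rfl
  · rfl

/-- `hoff`: a T_η-block not coming from Ω₀ is a single site off Ω₀ («Ω₀ is a union of … blocks»).
[cite: Balaban1985BackgroundPropagators, (3.18) p. 393, p. 394] -/
theorem offRange_compat (B : Y → Finset ↥Ω₁) (Γ : Y → ↥Ω₁ → List ↥Ω₁) (y : Y → ↥Ω₁)
    (cT : Y ⊕ {x' : Xt // id x' ∉ Ω₁}) (hc : cT ∉ Set.range (ιS Ω₁ S)) :
    ∃ x, x ∉ S ∧ extB Ω₁ id Subtype.val B cT = {x} ∧ extY Ω₁ id Subtype.val y cT = x ∧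
      extΓ Ω₁ id Subtype.val Γ cT x = [] := by
  rcases cT with c | ⟨x, hx⟩
  · exact absurd ⟨Sum.inl c, rfl⟩ hc
  · have hxS : x ∉ S := fun hxS => hc ⟨Sum.inr ⟨⟨x, hxS⟩, hx⟩, rfl⟩
    exact ⟨x, hxS, rfl, rfl, rfl⟩

variable {V : Type*} [NormedAddCommGroup V] [InnerProductSpace ℝ V] (τ : Xt → Xt → V →ₗ[ℝ] V)
  (w : Y → ↥Ω₁ → ℝ) (B : Y → Finset ↥Ω₁) (Γ : Y → ↥Ω₁ → List ↥Ω₁) (y : Y → ↥Ω₁)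

/-- **The T_η-constraints Q_T**: (3.19) over the Ω₁-blocks and the 0-blocks at every site of T_η off Ω₁, as an
operator on L²(T_η, 𝔤). [cite: Balaban1985BackgroundPropagators, (3.18)-(3.19) p. 393] -/
noncomputable abbrev qT : PiLp 2 (fun _ : Xt => V) →ₗ[ℝ] PiLp 2 (fun _ : Y ⊕ {x' : Xt // id x' ∉ Ω₁} => V) :=
  qL τ (extW Ω₁ id w) (extB Ω₁ id Subtype.val B) (extΓ Ω₁ id Subtype.val Γ) (extY Ω₁ id Subtype.val y)

/-- **The constructed Q′ of (3.18) on Ω₀ ⊇ Ω₁**: (3.19) over the Ω₁-blocks and (Q′λ)(y) = λ(y) on Λ₀ = Ω₀ ∖ Ω₁, as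
an operator L²(Ω₀, 𝔤) → L²(𝔅). [cite: Balaban1985BackgroundPropagators, (3.18)-(3.19) p. 393] -/
noncomputable abbrev qS : PiLp 2 (fun _ : ↥S => V) →ₗ[ℝ] PiLp 2 (fun _ : Y ⊕ {x : ↥S // (x : Xt) ∉ Ω₁} => V) :=
  qL (resT S τ) (extW Ω₁ (Subtype.val : ↥S → Xt) w) (extB Ω₁ Subtype.val (inclS Ω₁ S hΩ) B)
    (extΓ Ω₁ Subtype.val (inclS Ω₁ S hΩ) Γ) (extY Ω₁ Subtype.val (inclS Ω₁ S hΩ) y)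

/-- **Q′λ = 0 on Ω₀ ⟺ Q_T(Ω₀λ) = 0** — `hker` of `B9Eq321DirichletIndependence` §4 for the constructed systems,
with NO hypothesis. [cite: Balaban1985BackgroundPropagators, (3.18)-(3.19) p. 393, p. 394] -/
theorem qS_ker_iff (l : PiLp 2 (fun _ : ↥S => V)) :
    qS Ω₁ S hΩ τ w B Γ y l = 0 ↔ qT Ω₁ τ w B Γ y (extS S l) = 0 :=
  qL_ker_iff_of_compat S τ _ _ _ _ _ _ _ _ (ιS Ω₁ S) (extB_compat Ω₁ S hΩ B) (extW_compat Ω₁ S w)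
    (extΓ_compat Ω₁ S hΩ Γ) (extY_compat Ω₁ S hΩ y) (offRange_compat Ω₁ S B Γ y) l

/-- The solutions of Q_Tμ = 0 vanish off Ω₁ (every site there is a 0-block with weight 1).
[cite: Balaban1985BackgroundPropagators, (3.18) p. 393, p. 394] -/
theorem apply_eq_zero_of_qT (μ : PiLp 2 (fun _ : Xt => V)) (hμ : qT Ω₁ τ w B Γ y μ = 0) (z : Xt)
    (hz : z ∉ Ω₁) : μ z = 0 :=
  apply_eq_zero_of_qL_singletons τ _ _ _ _ Ω₁ (singleton_T Ω₁ w B Γ y) μ hμ z hz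

/-- **«By the definition of space N(Q′) the functions λ in (3.22) vanish on Ω₁^c»**: for the constructed Q′ on Ω₀,
Q′λ = 0 forces λ = 0 on Λ₀ = Ω₀ ∖ Ω₁. [cite: Balaban1985BackgroundPropagators, (3.18) p. 393, p. 394] -/
theorem apply_eq_zero_of_qS (l : PiLp 2 (fun _ : ↥S => V)) (hl : qS Ω₁ S hΩ τ w B Γ y l = 0) (x : ↥S)
    (hx : (x : Xt) ∉ Ω₁) : l x = 0 := by
  rw [← extS_apply_coe S l x]
  exact apply_eq_zero_of_qT Ω₁ τ w B Γ y (extS S l) ((qS_ker_iff Ω₁ S hΩ τ w B Γ y l).1 hl) x hx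

end Instances

/-! ## §3  Thm 3.11 «obvious» and «R … does not depend on Ω₀» for the constructed systems -/

section Assembled

variable [Fintype Xt] {V : Type*} [NormedAddCommGroup V] [InnerProductSpace ℝ V] [FiniteDimensional ℝ V]
  (τ : Xt → Xt → V →ₗ[ℝ] V) (bonds : Finset (Xt × Xt)) (cb : Xt × Xt → ℝ) [Fintype Y]
  (w : Y → ↥Ω₁ → ℝ) (B : Y → Finset ↥Ω₁) (Γ : Y → ↥Ω₁ → List ↥Ω₁) (y : Y → ↥Ω₁)

omit [FiniteDimensional ℝ V] [Fintype Y] in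
/-- ‖Ω₀λ‖ = ‖λ‖ (extension by zero is an isometry; = `B9Eq321DirichletIndependence.norm_extS` of its v1.1, restated
privately so that this file elaborates against either version). [folklore] -/
private theorem norm_extS_eq (S : Finset Xt) (f : PiLp 2 (fun _ : ↥S => V)) : ‖extS S f‖ = ‖f‖ := by
  rw [norm_eq_sqrt_real_inner (extS S f), norm_eq_sqrt_real_inner f, inner_extS_left, resS_extS]

/-- **Thm 3.11 «obvious for the first three operators» for the constructed Q′ on Ω₀**: the (3.25)-data (G′ =
(Δ′_a)⁻¹, (Q′G′²Q′\*)⁻¹, Q′\* = the adjoint) of the Dirichlet operator Ω₀Δ_TΩ₀ EXIST at every background —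
injective transports, isometric on the bonds entering Ω₀; positive bond weights; a_c > 0; the Ω₁-blocks a block
system for the bonds inside Ω₁. [cite: Balaban1985BackgroundPropagators, Thm 3.11 p. 416, (3.18) p. 393,
(3.23)-(3.25) p. 394] -/
theorem exists_data_qS (S : Finset Xt) (hΩ : Ω₁ ⊆ S) (hinj : ∀ x x' : Xt, Function.Injective (τ x x'))
    (hcb : ∀ b ∈ bonds, 0 < cb b)
    (hiso : ∀ b ∈ bonds, b.1 ∉ S → b.2 ∈ S → ∀ u v : V, ⟪τ b.1 b.2 u, τ b.1 b.2 v⟫_ℝ = ⟪u, v⟫_ℝ)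
    (hS : IsBlockSystem (intBonds Ω₁ bonds) w B Γ y) (a : Y ⊕ {x : ↥S // (x : Xt) ∉ Ω₁} → ℝ)
    (ha : ∀ c, 0 < a c) :
    ∃ (g : PiLp 2 (fun _ : ↥S => V) →ₗ[ℝ] PiLp 2 (fun _ : ↥S => V))
      (cc : PiLp 2 (fun _ : Y ⊕ {x : ↥S // (x : Xt) ∉ Ω₁} => V) →ₗ[ℝ]
        PiLp 2 (fun _ : Y ⊕ {x : ↥S // (x : Xt) ∉ Ω₁} => V)),
      Data (resS S ∘ₗ lapL τ bonds cb ∘ₗ extS S) (qS Ω₁ S hΩ τ w B Γ y)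
        (LinearMap.adjoint (qS Ω₁ S hΩ τ w B Γ y)) (AL a) g cc :=
  exists_data_dirichlet S τ bonds cb hinj hcb hiso (isBlockSystem_S Ω₁ S hΩ hS) a ha

/-- **R DOES NOT DEPEND ON Ω₀ — free of the modelling hypotheses `hsing`/`hoff`/compatibility.**  T_η with its
covariant Laplacian Δ_T = D\*D ((3.23); bond weights c_b ≥ 0); ANY blocks on Ω₁ (weights, contours, centres); two
domains Ω₀ = S₁, Ω₀′ = S₂ containing Ω₁ and every site bonded to Ω₁ («we may add to Ω₁ a thinner layer …
surrounding Ω₁»); on each the CONSTRUCTED Q′ of (3.18) (`qS`) and ANY (3.25)-data (Q′\*, a, G′, (Q′G′²Q′\*)⁻¹ —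
existence = `exists_data_qS`) over the Dirichlet operator Ω₀Δ_TΩ₀.  Then Ω₀R↾Ω₀ = Ω₀′R′↾Ω₀′ on L²(T_η, 𝔤): «This
permits us to express R in terms of operators with some boundary conditions outside Ω₁ … we do not indicate this
fact in our notations». [cite: Balaban1985BackgroundPropagators, (3.18) p. 393, (3.21)+(3.23)+(3.25) p. 394] -/
theorem R325_dirichlet_indep (hcb : ∀ b ∈ bonds, 0 ≤ cb b) (S₁ S₂ : Finset Xt) (hΩ₁ : Ω₁ ⊆ S₁) (hΩ₂ : Ω₁ ⊆ S₂)
    (hlayer₁ : ∀ b ∈ bonds, (b.1 ∈ Ω₁ → b.2 ∈ S₁) ∧ (b.2 ∈ Ω₁ → b.1 ∈ S₁))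
    (hlayer₂ : ∀ b ∈ bonds, (b.1 ∈ Ω₁ → b.2 ∈ S₂) ∧ (b.2 ∈ Ω₁ → b.1 ∈ S₂))
    {qs₁ : PiLp 2 (fun _ : Y ⊕ {x : ↥S₁ // (x : Xt) ∉ Ω₁} => V) →ₗ[ℝ] PiLp 2 (fun _ : ↥S₁ => V)}
    {A₁ c₁ : PiLp 2 (fun _ : Y ⊕ {x : ↥S₁ // (x : Xt) ∉ Ω₁} => V) →ₗ[ℝ]
      PiLp 2 (fun _ : Y ⊕ {x : ↥S₁ // (x : Xt) ∉ Ω₁} => V)}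
    {g₁ : PiLp 2 (fun _ : ↥S₁ => V) →ₗ[ℝ] PiLp 2 (fun _ : ↥S₁ => V)}
    {qs₂ : PiLp 2 (fun _ : Y ⊕ {x : ↥S₂ // (x : Xt) ∉ Ω₁} => V) →ₗ[ℝ] PiLp 2 (fun _ : ↥S₂ => V)}
    {A₂ c₂ : PiLp 2 (fun _ : Y ⊕ {x : ↥S₂ // (x : Xt) ∉ Ω₁} => V) →ₗ[ℝ]
      PiLp 2 (fun _ : Y ⊕ {x : ↥S₂ // (x : Xt) ∉ Ω₁} => V)}
    {g₂ : PiLp 2 (fun _ : ↥S₂ => V) →ₗ[ℝ] PiLp 2 (fun _ : ↥S₂ => V)}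
    (h₁ : Data (resS S₁ ∘ₗ lapL τ bonds cb ∘ₗ extS S₁) (qS Ω₁ S₁ hΩ₁ τ w B Γ y) qs₁ A₁ g₁ c₁)
    (h₂ : Data (resS S₂ ∘ₗ lapL τ bonds cb ∘ₗ extS S₂) (qS Ω₁ S₂ hΩ₂ τ w B Γ y) qs₂ A₂ g₂ c₂) :
    extS S₁ ∘ₗ R325 (qS Ω₁ S₁ hΩ₁ τ w B Γ y) qs₁ g₁ c₁ ∘ₗ resS S₁
      = extS S₂ ∘ₗ R325 (qS Ω₁ S₂ hΩ₂ τ w B Γ y) qs₂ g₂ c₂ ∘ₗ resS S₂ :=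
  R325_dirichlet_indep_lattice τ bonds cb hcb Ω₁ _ _ _ _ (singleton_T Ω₁ w B Γ y) S₁ S₂ hΩ₁ hΩ₂ hlayer₁ hlayer₂
    _ _ (qS_ker_iff Ω₁ S₁ hΩ₁ τ w B Γ y) (qS_ker_iff Ω₁ S₂ hΩ₂ τ w B Γ y) h₁ h₂

/-- **The exponent ‖R(f↾Ω₀)‖ of (3.20) «(3.17) = exp(−(1/2α)‖RD\*A‖²)» does not depend on Ω₀** (same printed
hypotheses as `R325_dirichlet_indep`). [cite: Balaban1985BackgroundPropagators, (3.18) p. 393, (3.20)+(3.23)+(3.25)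
p. 394] -/
theorem norm_R325_resS_indep (hcb : ∀ b ∈ bonds, 0 ≤ cb b) (S₁ S₂ : Finset Xt) (hΩ₁ : Ω₁ ⊆ S₁)
    (hΩ₂ : Ω₁ ⊆ S₂) (hlayer₁ : ∀ b ∈ bonds, (b.1 ∈ Ω₁ → b.2 ∈ S₁) ∧ (b.2 ∈ Ω₁ → b.1 ∈ S₁))
    (hlayer₂ : ∀ b ∈ bonds, (b.1 ∈ Ω₁ → b.2 ∈ S₂) ∧ (b.2 ∈ Ω₁ → b.1 ∈ S₂))
    {qs₁ : PiLp 2 (fun _ : Y ⊕ {x : ↥S₁ // (x : Xt) ∉ Ω₁} => V) →ₗ[ℝ] PiLp 2 (fun _ : ↥S₁ => V)}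
    {A₁ c₁ : PiLp 2 (fun _ : Y ⊕ {x : ↥S₁ // (x : Xt) ∉ Ω₁} => V) →ₗ[ℝ]
      PiLp 2 (fun _ : Y ⊕ {x : ↥S₁ // (x : Xt) ∉ Ω₁} => V)}
    {g₁ : PiLp 2 (fun _ : ↥S₁ => V) →ₗ[ℝ] PiLp 2 (fun _ : ↥S₁ => V)}
    {qs₂ : PiLp 2 (fun _ : Y ⊕ {x : ↥S₂ // (x : Xt) ∉ Ω₁} => V) →ₗ[ℝ] PiLp 2 (fun _ : ↥S₂ => V)}
    {A₂ c₂ : PiLp 2 (fun _ : Y ⊕ {x : ↥S₂ // (x : Xt) ∉ Ω₁} => V) →ₗ[ℝ]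
      PiLp 2 (fun _ : Y ⊕ {x : ↥S₂ // (x : Xt) ∉ Ω₁} => V)}
    {g₂ : PiLp 2 (fun _ : ↥S₂ => V) →ₗ[ℝ] PiLp 2 (fun _ : ↥S₂ => V)}
    (h₁ : Data (resS S₁ ∘ₗ lapL τ bonds cb ∘ₗ extS S₁) (qS Ω₁ S₁ hΩ₁ τ w B Γ y) qs₁ A₁ g₁ c₁)
    (h₂ : Data (resS S₂ ∘ₗ lapL τ bonds cb ∘ₗ extS S₂) (qS Ω₁ S₂ hΩ₂ τ w B Γ y) qs₂ A₂ g₂ c₂)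
    (f : PiLp 2 (fun _ : Xt => V)) :
    ‖R325 (qS Ω₁ S₁ hΩ₁ τ w B Γ y) qs₁ g₁ c₁ (resS S₁ f)‖
      = ‖R325 (qS Ω₁ S₂ hΩ₂ τ w B Γ y) qs₂ g₂ c₂ (resS S₂ f)‖ := by
  have h := congrArg (fun T : PiLp 2 (fun _ : Xt => V) →ₗ[ℝ] PiLp 2 (fun _ : Xt => V) => ‖T f‖)
    (R325_dirichlet_indep Ω₁ τ bonds cb w B Γ y hcb S₁ S₂ hΩ₁ hΩ₂ hlayer₁ hlayer₂ h₁ h₂)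
  simp only [LinearMap.comp_apply] at h
  rwa [norm_extS_eq, norm_extS_eq] at h

end Assembled

/-! ## §4  Locality (v1.1, append-only): «They depend on the configuration U restricted to Ω₀» (p. 394) -/

section Locality

variable (S : Finset Xt) (hΩ : Ω₁ ⊆ S) {V : Type*} [NormedAddCommGroup V] [InnerProductSpace ℝ V]
  (w : Y → ↥Ω₁ → ℝ) (B : Y → Finset ↥Ω₁) (Γ : Y → ↥Ω₁ → List ↥Ω₁) (y : Y → ↥Ω₁)

/-- **The constructed Q′ on Ω₀ depends on U only through the transports between sites of Ω₀** (its contours run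
inside Ω₁ ⊂ Ω₀): p. 394 «The operators with the boundary conditions have a very important property. They depend on
the configuration U restricted to Ω₀.» [cite: Balaban1985BackgroundPropagators, (3.18)-(3.19) p. 393, p. 394] -/
theorem qS_congr {τ τ' : Xt → Xt → V →ₗ[ℝ] V} (h : ∀ x ∈ S, ∀ x' ∈ S, τ x x' = τ' x x') :
    qS Ω₁ S hΩ τ w B Γ y = qS Ω₁ S hΩ τ' w B Γ y := by
  show qL (resT S τ) _ _ _ _ = qL (resT S τ') _ _ _ _
  rw [resT_congr S h]

/-- Hence the (3.25) expression R = I − G′Q′\*(Q′G′²Q′\*)⁻¹Q′G′ built on the constructed Q′ (with any Q′\*, G′,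
(Q′G′²Q′\*)⁻¹) is the same for backgrounds agreeing on Ω₀.
[cite: Balaban1985BackgroundPropagators, (3.25) p. 394] -/
theorem R325_qS_congr [Fintype Y] {τ τ' : Xt → Xt → V →ₗ[ℝ] V} (h : ∀ x ∈ S, ∀ x' ∈ S, τ x x' = τ' x x')
    (qs : PiLp 2 (fun _ : Y ⊕ {x : ↥S // (x : Xt) ∉ Ω₁} => V) →ₗ[ℝ] PiLp 2 (fun _ : ↥S => V))
    (g : PiLp 2 (fun _ : ↥S => V) →ₗ[ℝ] PiLp 2 (fun _ : ↥S => V))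
    (c : PiLp 2 (fun _ : Y ⊕ {x : ↥S // (x : Xt) ∉ Ω₁} => V) →ₗ[ℝ]
      PiLp 2 (fun _ : Y ⊕ {x : ↥S // (x : Xt) ∉ Ω₁} => V)) :
    R325 (qS Ω₁ S hΩ τ w B Γ y) qs g c = R325 (qS Ω₁ S hΩ τ' w B Γ y) qs g c := by
  rw [qS_congr Ω₁ S hΩ w B Γ y h]

variable [Fintype Xt] [Fintype Y] [FiniteDimensional ℝ V] (bonds : Finset (Xt × Xt)) (cb : Xt × Xt → ℝ)

/-- **G′, (Q′G′²Q′\*)⁻¹ (hence R, H′) of the Dirichlet problem with the constructed Q′ are functions of U↾Ω₀**: a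
(3.25)-datum for U (Dirichlet operator Ω₀Δ_T(U)Ω₀, Q′ = `qS … τ …`, Q′\* its adjoint) is a (3.25)-datum for every
U′ that agrees with U on the pairs of sites of Ω₀, both isometric on the bonds entering Ω₀ (c_b ≥ 0) —
`B9Eq323DirichletSplit.data_dirichlet_local` for the constructed Q′.
[cite: Balaban1985BackgroundPropagators, (3.23)-(3.25) p. 394] -/
theorem data_qS_local {τ τ' : Xt → Xt → V →ₗ[ℝ] V} (hcb : ∀ b ∈ bonds, 0 ≤ cb b)
    (hiso : ∀ b ∈ bonds, b.1 ∉ S → b.2 ∈ S → ∀ u v : V, ⟪τ b.1 b.2 u, τ b.1 b.2 v⟫_ℝ = ⟪u, v⟫_ℝ)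
    (hiso' : ∀ b ∈ bonds, b.1 ∉ S → b.2 ∈ S → ∀ u v : V, ⟪τ' b.1 b.2 u, τ' b.1 b.2 v⟫_ℝ = ⟪u, v⟫_ℝ)
    (h : ∀ x ∈ S, ∀ x' ∈ S, τ x x' = τ' x x')
    {A : PiLp 2 (fun _ : Y ⊕ {x : ↥S // (x : Xt) ∉ Ω₁} => V) →ₗ[ℝ]
      PiLp 2 (fun _ : Y ⊕ {x : ↥S // (x : Xt) ∉ Ω₁} => V)}
    {g : PiLp 2 (fun _ : ↥S => V) →ₗ[ℝ] PiLp 2 (fun _ : ↥S => V)}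
    {cc : PiLp 2 (fun _ : Y ⊕ {x : ↥S // (x : Xt) ∉ Ω₁} => V) →ₗ[ℝ]
      PiLp 2 (fun _ : Y ⊕ {x : ↥S // (x : Xt) ∉ Ω₁} => V)}
    (hdata : Data (resS S ∘ₗ lapL τ bonds cb ∘ₗ extS S) (qS Ω₁ S hΩ τ w B Γ y)
      (LinearMap.adjoint (qS Ω₁ S hΩ τ w B Γ y)) A g cc) :
    Data (resS S ∘ₗ lapL τ' bonds cb ∘ₗ extS S) (qS Ω₁ S hΩ τ' w B Γ y)
      (LinearMap.adjoint (qS Ω₁ S hΩ τ' w B Γ y)) A g cc :=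
  data_dirichlet_local S bonds cb hcb hiso hiso' h _ _ _ _ hdata

end Locality

end Literature.MathematicalPhysics.QuantumFieldTheory.Balaban1983to89.B9Eq318DirichletBlocks
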